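import Summits.QuantumFields.YangMills.Theorems.BalabanUVNodesK0AxJoinResidualLimHalf
import Literature.Probability.LatticeModels.ClusterExpansionKPBound

/-!
# LENS-1 g8 (v1.1) — THE TWO-VOLUME RATE ROAD TO `hRate` (✓p812885): the letter [E] = lens-1's READING of [I] (1.7)+(1.18) as an exp-in-period
# two-volume Cauchy estimate on the kernel (print states EXISTENCE only), the Kotecký–Preiss two-volume engine PROVED generically
# (clusters leaving the shared window cost `e^{−R}`; UNCONSUMED at the record in this file), and the K0ᴬ door BY NAME

LANDED VERBATIM (declarations and proofs byte-identical to v1 3f1b5f522133aa01 ∕ v1.1 4218d3d4ead8dc30 — v1.1 = v1 with ◆'s docstring relabels; this one paragraph added) by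
porter PTC-1 g3 (`ymgap-nodeO-port-PTC-1`, K0ᴬ JOIN pen) as `Summits/QuantumFields/YangMills/Theorems/BalabanUVNodesK0AxTwoVolumeRate.lean` `--supports stmt-QuantumFields-27238
--as helper` on ★★★ director-ym g21 №526 (i) («▶ PTC-1: LAND v1 as `…/Theorems/BalabanUVNodesK0AxTwoVolumeRate.lean` … after ◆'s (4) statement-dedup `rg` … header «§2 engine
unconsumed here», citation «limit exists by (1.7)» with NO printed rate — GO») and ◆ CRIT-1 g35's CUT 07:12:30Z (SURVIVES·PRICED; pen released).  Lander's dedup census: the five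
§2 KP lemma NAMES have 0 hits in `Summits/` ∕ `Literature/` (incl. `ClusterExpansionKPBound` ∕ `SoloInformedPolymerActivity`); statement-level dedup = the gate's `dedup.landed`
at filing.  §2 = ENGINE, UNCONSUMED HERE (orphans by design).  AUTHORSHIP = ◇ lens-1 g8 (HOME `pub/ym-nodeO-ideate/nodeO-cover/LENS-1g8-TwoVolumeRate-v1.1.lean`).
Cell `ym-nodeO-ideate`, seat ◇ LENS IDEATOR 1 g8 (`ymgap-nodeO-lens-1-g8`; count-neutral sketch; docket ★★★ director-ym g21 №525 (2),
nodeO STATUS 2026-08-31T06:53:06Z; ◆ CRIT-1 g35 CUT 07:12:30Z SURVIVES·PRICED — J1′ PASS on the one letter, S-wrap EXEMPT, costume audit UPHELD;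
★★★ №526 (i): [E] booked as the common first letter of both K0ᴬ doors in the tempered wording used below).  v1.1 = v1 (3f1b5f522133aa01)
with DOCSTRING relabels only (◆ (2)(e)∕(4): «reading of (1.7)+(1.18); print states existence only»; «§2 engine unconsumed here»); statements unchanged.  Target BY NAME: the binder `hRate` of ✓p812885
`Summits/QuantumFields/YangMills/Theorems/BalabanUVNodesK0AxJoinResidualLimHalf.lean ::
Summit.QuantumFields.YangMills.Theorems.K0AxJoinResidual.record13SepCoPHInhabitedAx_of_twoVolumeRate_pvolDecayEv_tokFree` (:97).

WHAT THIS TYPES.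
§1 GENERIC (folklore, PROVED): an exponential tail in a growing scale `|D K| ≤ E₀·exp(−κ·R K)`, `K ≤ R K` eventually, `κ > 0`, IS an
   eventually-geometric rate row `∃ C r, r < 1 ∧ ∃ K₀, ∀ K ≥ K₀, |D K| ≤ C·r^K` (`geomRow_of_expScale`); and the torus scale
   `(F.P K).sitesPerDir (k+1) = 2·L^{m+K−k−1}` dominates `K` for `K ≥ 2k+2` (`natCast_le_sitesPerDir`).
§2 THE KOTECKÝ–PREISS TWO-VOLUME ENGINE (PROVED, generic over a countable polymer system; consumes BY NAME the tree's discharge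
   `Literature.Probability.LatticeModels.koteckyPreiss_truncatedWeight_bound_holds` of [KP86, Thm p.492 (4)]; ENGINE, UNCONSUMED HERE — nothing in this
   file instantiates the polymer space with Bałaban's localized terms (◆ (3)); it becomes load-bearing in v2, where the term-functional letter [F] feeds it):
   * `markedSum_eq_shared_add` — the marked cluster sum `Σ_{C ⊆ Λ, γ₀ ∈ C} Φᵀ(C)` of a finite volume `Λ ⊇ S` splits into the part inside the
     SHARED window `S` plus the part of the clusters LEAVING `S` (kernel: `Finset.sum_filter_add_sum_filter_not`);
   * `norm_markedSum_sub_markedSum_le` — ★ two finite volumes `Λ, Λ'` containing the same window `S`, every polymer of `Λ ∪ Λ'` outside `S` having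
     KP-size `d ≥ R`: the marked cluster sums differ by `≤ 2·e^{−R}·a(γ₀)` (the shared parts CANCEL; each leaving part is a KP tail,
     `sum_norm_truncatedWeight_le_exp_neg_mul`).  This is the kernel form of «difference = Σ over clusters touching V_{K+1} ∖ V_K ⇒ ≤ C·r^K»;
   * `norm_markedSum_filter_le_exp_neg` — the (5.10)-type companion: the clusters through `γ₀` satisfying a predicate that forces size `≥ r`
     (e.g. «reaches the site z», `r = |z|₁`) weigh `≤ e^{−r}·a(γ₀)`;
   * `geomRow_re_markedSum_of_sharedKP` — a `K`-indexed family of volumes `Λ K` with windows `S K ⊆ Λ K ∩ Λ (K+1)` and off-window sizes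
     `≥ R K ≥ K`: the real parts of the marked sums obey the RATE ROW of ✓p812885 (§1 ∘ ★).
§3 AT THE RECORD — ONE displayed letter [E], lens-1's READING of [I] (1.7)+(1.18) ([I] p.264 L19–20 prints only «This limit exists by the localized
   representation (1.7)» — EXISTENCE, no rate; the exp-in-period rate is what the localized representation would deliver, read by this seat, not printed):
   `RecordPvolTwoVolExpOnRunsAx F a₀ ε₂₉ γ E₀ κ` := «κ > 0 and along every `]0, γ]`-run, for all `k ≤ n`, `(μ, ν, z)`, eventually in `K`:
   `|recordPvolAx … (K+1) μ ν z − recordPvolAx … K μ ν z| ≤ E₀·exp(−κ·(F.P K).sitesPerDir (k+1))`» — a TWO-VOLUME DIFFERENCE of the kernel letter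
   (S-wrap EXEMPT, ★★★ №515 (2) ∕ J5′ №517 (1)); quantifier guard «∀ z, eventually in K» (never «∀ᶠ K, ∀ z»).
   * `twoVolumeRateRow_of_twoVolExp` — the letter ⟹ the rate row of ✓p812885 (§1);
   * `recordPolLimitOnRunsAx_of_twoVolExp` — ⟹ (L-lim) `RecordPolLimitOnRunsAx F a₀ ε₂₉ γ` BY NAME (`recordPolLimitOnRunsAx_of_twoVolumeGeomRate`);
   * ★★★ `hRate_of_twoVolExp` — the binder `hRate` of ✓p812885 VERBATIM from the letter supplied under the token-free JOIN antecedents in the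
     threshold form «∃ εL > 0, ∀ ε₂₉ ≤ εL, ∃ γ₀ > 0, ∀ γ ≤ γ₀, ∃ E₀ κ, …»;
   * ★★★ `record13SepCoPHInhabitedAx_of_twoVolExp_pvolDecayEv_tokFree` — K0ᴬ BY NAME from the letter ∧ (L-dec)′ ∧ (R-Uk) ∧ (R-Bg), via ✓p812885.
HOW §2 WOULD INHABIT §3 (the READING, not asserted): [II] (1.33)–(1.36) ∕ [III] Thm 1 organise the `k+1`-st fluctuation integral on `𝕋_K` as a
polymer gas of localization domains whose activities are VOLUME-UNIVERSAL below the wrapping scale `R_K ≍ L^{m+K−k−1}` (the window `S K` = the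
unwrapped domains of radius `< R_K`, literally shared by `𝕋_K`, `𝕋_{K+1}` and `ℤ⁴` — `truncatedWeight_image`), the kernel entry being a marked
cluster functional; ★ then gives §3's letter with `κ·R_K` in the exponent.  At the KERNEL-ENTRY level every «∃ polymer gas …» dressing of the
letter is kernel-equivalent to (§3's letter ∧ uniform decay) — a one-polymer gas fakes it — so the displayed object is the undressed letter and the
polymer content lives in the generic theorem ★ (LENS-1g8-TwoVolumeRate-v1.md, «costume audit»).

HONEST FRAMING.  CONDITIONAL helpers + generic folklore∕KP lemmas; §3's letter, (L-dec)′ and P0 are OPEN Bałaban-strength content ([I] (1.7) p.261,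
(1.18) p.263, (1.21) p.264, (5.10) p.293; [II] (1.33)–(1.36); [III] Thm 1 p.262; [15] Prop. 9 p.309) — displayed, not proved; nothing of Bałaban is
asserted, ported, discharged or refuted; K0ᴬ stmt-QuantumFields-27238 OPEN; NODE O not inhabited (0∕1); COUNT 8∕28 · K 1∕4 UNMOVED; finite
`𝕋⁴_{L^K}` at fixed ε — NOT continuum ∕ ℝ⁴ ∕ OS.  The multi-scale localized terms of (1.7) are NOT a single-scale plaquette-polymer gas at weak
coupling, so `Summit.QuantumFields.YangMills.Theorems.not_summable_koteckyPreiss_majorant` (`s > 1/2`) does not bear on ★'s hypothesis (1) as it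
would be instantiated (activities `E₀ ε·exp(−κ d_k(Y))` with `κ` large, [I] (0.25)–(0.26)); it is recorded, not beaten.  **The Yang–Mills mass gap
(Clay) is NOT proved by any of this.**  One new displayed `def` (§3); no `sorry`, `instance`, `axiom`, `notation`; standard axioms only.
-/

noncomputable section

open scoped BigOperators Topology
open Filter

namespace Summit.QuantumFields.YangMills.Theorems.K0AxTwoVolumeRate

open Summit.QuantumFields.YangMills.Theorems.K0RecordFormatNames
open Summit.QuantumFields.YangMills.Theorems
open Summit.QuantumFields.YangMills.Theorems.PortHRecordJoin
open Summit.QuantumFields.YangMills.Theorems.K0AxJoinResidual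
open Literature.MathematicalPhysics.QuantumFieldTheory.Balaban1983to89
open Literature.MathematicalPhysics.QuantumFieldTheory.Balaban1983to89.Node00
open Literature.MathematicalPhysics.QuantumFieldTheory.Balaban1983to89.T4Continuum (T4Family)
open Literature.MathematicalPhysics.QuantumFieldTheory.Balaban1983to89.FlowStep
open Literature.MathematicalPhysics.QuantumFieldTheory.Balaban1983to89.FlowStepRuns
open Literature.Probability.LatticeModels

/-! ## §1  Generic: an exponential tail in a growing scale is an eventually-geometric rate row -/

/-- **Tail in a growing scale ⟹ geometric rate row.**  `|D K| ≤ E₀·e^{−κ R_K}` for `K ≥ K₀`, `κ > 0`, `K ≤ R_K` for `K ≥ K₁`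
⟹ `∃ C r, r < 1 ∧ ∃ K₂, ∀ K ≥ K₂, |D K| ≤ C·r^K` (`C = |E₀|`, `r = e^{−κ}`). [folklore] -/
theorem geomRow_of_expScale {D : ℕ → ℝ} {E₀ κ : ℝ} (hκ : 0 < κ) {R : ℕ → ℝ} {K₁ K₀ : ℕ}
    (hR : ∀ K : ℕ, K₁ ≤ K → (K : ℝ) ≤ R K) (h : ∀ K : ℕ, K₀ ≤ K → |D K| ≤ E₀ * Real.exp (-(κ * R K))) :
    ∃ C r : ℝ, r < 1 ∧ ∃ K₂ : ℕ, ∀ K : ℕ, K₂ ≤ K → |D K| ≤ C * r ^ K := by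
  refine ⟨|E₀|, Real.exp (-κ), Real.exp_lt_one_iff.2 (by linarith), max K₀ K₁, fun K hK => ?_⟩
  have hK₀ : K₀ ≤ K := le_trans (le_max_left _ _) hK
  have hK₁ : K₁ ≤ K := le_trans (le_max_right _ _) hK
  have hpow : Real.exp (-κ) ^ K = Real.exp (-(κ * K)) := by
    rw [← Real.exp_nat_mul]; ring_nf
  calc |D K| ≤ E₀ * Real.exp (-(κ * R K)) := h K hK₀
    _ ≤ |E₀| * Real.exp (-(κ * R K)) := mul_le_mul_of_nonneg_right (le_abs_self _) (Real.exp_nonneg _)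
    _ ≤ |E₀| * Real.exp (-(κ * K)) := by
        refine mul_le_mul_of_nonneg_left (Real.exp_le_exp.2 ?_) (abs_nonneg _)
        have := mul_le_mul_of_nonneg_left (hR K hK₁) hκ.le
        linarith
    _ = |E₀| * Real.exp (-κ) ^ K := by rw [hpow]

/-- **The torus period dominates the volume exponent**: `K ≤ (F.P K).sitesPerDir (k+1) = 2·L^{m+K−k−1}` for `K ≥ 2k+2` (`L ≥ 2`).
[cite: Balaban1987RG1, (0.1) p.251 (bookkeeping)] -/
theorem natCast_le_sitesPerDir (F : T4Family) (k : ℕ) :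
    ∀ K : ℕ, 2 * k + 2 ≤ K → (K : ℝ) ≤ (((F.P K).sitesPerDir (k + 1) : ℕ) : ℝ) := by
  intro K hK
  obtain ⟨t, rfl⟩ := Nat.exists_eq_add_of_le (show k + 1 ≤ K by omega)
  have hsp : (F.P (k + 1 + t)).sitesPerDir (k + 1) = 2 * F.L ^ (F.m + t) := by
    simp only [Params.sitesPerDir, T4Family.P_L, T4Family.P_m, T4Family.P_K]
    congr 2
    omega
  have hL2 : 2 ≤ F.L := by have := F.hL11; omega
  have h1 : t < 2 ^ t := Nat.lt_two_pow_self
  have h2 : 2 ^ t ≤ F.L ^ t := Nat.pow_le_pow_left hL2 t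
  have h3 : F.L ^ t ≤ F.L ^ (F.m + t) := Nat.pow_le_pow_right (by omega) (by omega)
  have h4 : k + 1 + t ≤ 2 * F.L ^ (F.m + t) := by omega
  rw [hsp]
  exact_mod_cast h4

/-! ## §2  The Kotecký–Preiss two-volume engine (generic; KP estimate (4) consumed BY NAME) -/

section KP

variable {P : Type*} [DecidableEq P] {inc : P → P → Prop} [DecidableRel inc]

omit [DecidableRel inc] in
/-- **Window split of a marked cluster sum**: for `S ⊆ Λ`, `Σ_{C ⊆ Λ, γ₀ ∈ C} Φᵀ(C) = Σ_{C ⊆ S, γ₀ ∈ C} Φᵀ(C) + Σ_{C ⊆ Λ, C ⊄ S, γ₀ ∈ C} Φᵀ(C)`.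
[folklore] -/
theorem markedSum_eq_shared_add [DecidableRel inc] (w : P → ℂ) {Λ S : Finset P} (hS : S ⊆ Λ) (γ₀ : P) :
    ∑ C ∈ Λ.powerset with γ₀ ∈ C, truncatedWeight inc w C =
      (∑ C ∈ S.powerset with γ₀ ∈ C, truncatedWeight inc w C) +
        ∑ C ∈ (Λ.powerset.filter fun C => ¬ C ⊆ S) with γ₀ ∈ C, truncatedWeight inc w C := by
  rw [← Finset.sum_filter_add_sum_filter_not (Λ.powerset.filter fun C => γ₀ ∈ C) (fun C => C ⊆ S)]
  congr 1
  · refine Finset.sum_congr ?_ fun _ _ => rfl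
    ext C
    simp only [Finset.mem_filter, Finset.mem_powerset]
    constructor
    · rintro ⟨⟨-, h2⟩, h3⟩
      exact ⟨h3, h2⟩
    · rintro ⟨h3, h2⟩
      exact ⟨⟨h3.trans hS, h2⟩, h3⟩
  · refine Finset.sum_congr ?_ fun _ _ => rfl
    ext C
    simp only [Finset.mem_filter, Finset.mem_powerset]
    tauto

/-- **The part of a marked cluster sum LEAVING the window is a KP tail**: if every polymer of `Λ` outside `S` has size `d ≥ R`, then under
KP's hypothesis (1) `‖Σ_{C ⊆ Λ, C ⊄ S, γ₀ ∈ C} Φᵀ(C)‖ ≤ e^{−R}·a(γ₀)` — estimate (4) of [KP86] consumed BY NAME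
(`koteckyPreiss_truncatedWeight_bound_holds`, `sum_norm_truncatedWeight_le_exp_neg_mul`). [cite: KoteckyPreiss1986, Theorem p. 492, estimate (4)] -/
theorem norm_markedSum_leaving_le [Countable P] [Std.Refl inc] [Std.Symm inc] {w : P → ℂ} {a d : P → ℝ}
    (ha : ∀ γ, 0 ≤ a γ) (hd : ∀ γ, 0 ≤ d γ)
    (h1 : ∀ γ, Summable (fun γ' : {γ' : P // inc γ' γ} => ‖w γ'‖ * Real.exp (a γ' + d γ')) ∧
      ∑' γ' : {γ' : P // inc γ' γ}, ‖w γ'‖ * Real.exp (a γ' + d γ') ≤ a γ)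
    {Λ S : Finset P} {R : ℝ} (hR : ∀ γ ∈ Λ, γ ∉ S → R ≤ d γ) (γ₀ : P) :
    ‖∑ C ∈ (Λ.powerset.filter fun C => ¬ C ⊆ S) with γ₀ ∈ C, truncatedWeight inc w C‖ ≤ Real.exp (-R) * a γ₀ := by
  have hfact := koteckyPreiss_truncatedWeight_bound_holds inc w a d
  refine (norm_sum_le _ _).trans ?_
  refine sum_norm_truncatedWeight_le_exp_neg_mul hfact ha hd h1 _ γ₀ fun C hC _ => ?_
  obtain ⟨hCΛ, hCS⟩ := Finset.mem_filter.1 hC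
  obtain ⟨γ, hγC, hγS⟩ := Finset.not_subset.1 hCS
  exact (hR γ (Finset.mem_powerset.1 hCΛ hγC) hγS).trans
    (Finset.single_le_sum (fun γ' _ => hd γ') hγC)

/-- ★ **THE KOTECKÝ–PREISS TWO-VOLUME ENGINE.**  Two finite volumes `Λ, Λ'` of one countable polymer system (reflexive symmetric
incompatibility, activities `w`, KP data `a, d ≥ 0` with hypothesis (1)) containing the SAME window `S`, every polymer of `Λ` or `Λ'` outside
`S` having size `d ≥ R`: the marked cluster sums differ by at most `2·e^{−R}·a(γ₀)` — the clusters inside the window CANCEL, the leaving ones are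
tails.  (In a thermodynamic limit over tori: `S` = the domains below the wrapping scale, shared verbatim by consecutive tori and `ℤᵈ`,
`truncatedWeight_image`; `R` = that scale.) [cite: KoteckyPreiss1986, Theorem p. 492, estimate (4); Balaban1987RG1, (1.21) p.264] -/
theorem norm_markedSum_sub_markedSum_le [Countable P] [Std.Refl inc] [Std.Symm inc] {w : P → ℂ} {a d : P → ℝ}
    (ha : ∀ γ, 0 ≤ a γ) (hd : ∀ γ, 0 ≤ d γ)
    (h1 : ∀ γ, Summable (fun γ' : {γ' : P // inc γ' γ} => ‖w γ'‖ * Real.exp (a γ' + d γ')) ∧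
      ∑' γ' : {γ' : P // inc γ' γ}, ‖w γ'‖ * Real.exp (a γ' + d γ') ≤ a γ)
    {Λ Λ' S : Finset P} (hS : S ⊆ Λ) (hS' : S ⊆ Λ') {R : ℝ}
    (hR : ∀ γ ∈ Λ, γ ∉ S → R ≤ d γ) (hR' : ∀ γ ∈ Λ', γ ∉ S → R ≤ d γ) (γ₀ : P) :
    ‖(∑ C ∈ Λ.powerset with γ₀ ∈ C, truncatedWeight inc w C) - ∑ C ∈ Λ'.powerset with γ₀ ∈ C, truncatedWeight inc w C‖
      ≤ 2 * (Real.exp (-R) * a γ₀) := by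
  rw [markedSum_eq_shared_add w hS γ₀, markedSum_eq_shared_add w hS' γ₀, add_sub_add_left_eq_sub]
  refine (norm_sub_le _ _).trans ?_
  have h₁ := norm_markedSum_leaving_le (inc := inc) ha hd h1 hR γ₀
  have h₂ := norm_markedSum_leaving_le (inc := inc) ha hd h1 hR' γ₀
  linarith

/-- **The (5.10)-type companion** (decay): the clusters through `γ₀` that satisfy a predicate `Q` forcing size `≥ r` (e.g. «`C` reaches the
site `z`», `r = κ|z|₁`) weigh at most `e^{−r}·a(γ₀)`. [cite: KoteckyPreiss1986, Theorem p. 492, estimate (4); Balaban1987RG1, (5.10) p.293] -/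
theorem norm_markedSum_filter_le_exp_neg [Countable P] [Std.Refl inc] [Std.Symm inc] {w : P → ℂ} {a d : P → ℝ}
    (ha : ∀ γ, 0 ≤ a γ) (hd : ∀ γ, 0 ≤ d γ)
    (h1 : ∀ γ, Summable (fun γ' : {γ' : P // inc γ' γ} => ‖w γ'‖ * Real.exp (a γ' + d γ')) ∧
      ∑' γ' : {γ' : P // inc γ' γ}, ‖w γ'‖ * Real.exp (a γ' + d γ') ≤ a γ)
    (Λ : Finset P) (Q : Finset P → Prop) [DecidablePred Q] {r : ℝ} (γ₀ : P)
    (hr : ∀ C ∈ Λ.powerset, Q C → γ₀ ∈ C → r ≤ ∑ γ' ∈ C, d γ') :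
    ‖∑ C ∈ (Λ.powerset.filter Q) with γ₀ ∈ C, truncatedWeight inc w C‖ ≤ Real.exp (-r) * a γ₀ := by
  have hfact := koteckyPreiss_truncatedWeight_bound_holds inc w a d
  refine (norm_sum_le _ _).trans ?_
  refine sum_norm_truncatedWeight_le_exp_neg_mul hfact ha hd h1 _ γ₀ fun C hC hγ => ?_
  obtain ⟨hCΛ, hQ⟩ := Finset.mem_filter.1 hC
  exact hr C hCΛ hQ hγ

/-- **KP two-volume engine ⟹ the RATE ROW of ✓p812885.**  A `K`-indexed family of finite volumes `Λ K` with windows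
`S K ⊆ Λ K ∩ Λ (K+1)`, off-window sizes `≥ R K`, and `K ≤ R K` eventually: the real parts of the marked cluster sums obey
`∃ C r, r < 1 ∧ ∃ K₀, ∀ K ≥ K₀, |O (K+1) − O K| ≤ C·r^K`. [cite: KoteckyPreiss1986, Theorem p. 492, estimate (4); Balaban1987RG1, (1.21) p.264] -/
theorem geomRow_re_markedSum_of_sharedKP [Countable P] [Std.Refl inc] [Std.Symm inc] {w : P → ℂ} {a d : P → ℝ}
    (ha : ∀ γ, 0 ≤ a γ) (hd : ∀ γ, 0 ≤ d γ)
    (h1 : ∀ γ, Summable (fun γ' : {γ' : P // inc γ' γ} => ‖w γ'‖ * Real.exp (a γ' + d γ')) ∧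
      ∑' γ' : {γ' : P // inc γ' γ}, ‖w γ'‖ * Real.exp (a γ' + d γ') ≤ a γ)
    (Λ S : ℕ → Finset P) (hS : ∀ K, S K ⊆ Λ K) (hS' : ∀ K, S K ⊆ Λ (K + 1)) (R : ℕ → ℝ)
    (hR : ∀ K, ∀ γ ∈ Λ K, γ ∉ S K → R K ≤ d γ) (hR' : ∀ K, ∀ γ ∈ Λ (K + 1), γ ∉ S K → R K ≤ d γ)
    {K₁ : ℕ} (hK : ∀ K : ℕ, K₁ ≤ K → (K : ℝ) ≤ R K) (γ₀ : P) :
    ∃ C r : ℝ, r < 1 ∧ ∃ K₀ : ℕ, ∀ K : ℕ, K₀ ≤ K →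
      |(∑ C ∈ (Λ (K + 1)).powerset with γ₀ ∈ C, truncatedWeight inc w C).re
          - (∑ C ∈ (Λ K).powerset with γ₀ ∈ C, truncatedWeight inc w C).re| ≤ C * r ^ K := by
  refine geomRow_of_expScale (E₀ := 2 * a γ₀) (κ := 1) one_pos (K₀ := 0) hK fun K _ => ?_
  rw [← Complex.sub_re, one_mul]
  refine (Complex.abs_re_le_norm _).trans ?_
  have h := norm_markedSum_sub_markedSum_le (inc := inc) ha hd h1 (hS' K) (hS K) (hR' K) (hR K) γ₀
  linarith

end KP

/-! ## §3  At the record: the letter [E] (reading of (1.7)+(1.18); print states existence only), the rate row, (L-lim), `hRate` and the K0ᴬ door BY NAME -/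

/-- ★★★ **ONE displayed letter [E] — the exp-in-period TWO-VOLUME CAUCHY LETTER on the kernel** `RecordPvolTwoVolExpOnRunsAx F a₀ ε₂₉ γ E₀ κ`
(lens-1's READING of [I] (1.7)+(1.18); [I] p.264 L19–20 states EXISTENCE of the (1.21) limit only — no rate is printed):
`κ > 0`, and along every `]0, γ]`-run of the record's own (0.20), for every `k ≤ n` and every kernel entry `(μ, ν, z)`, EVENTUALLY in the
volume exponent `K`, consecutive finite-volume kernels differ by at most `E₀·exp(−κ·(F.P K).sitesPerDir (k+1))`
(`(F.P K).sitesPerDir (k+1) = 2L^{m+K−k−1}` = the period of `𝕋^{(k+1)}_K`, below which localization domains do not wrap).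
READING (not print's text): [I] p.264 «This limit exists by the localized representation (1.7)» — the localized representation with the (1.18)
bounds would deliver a rate exponential in the torus period, which is what the KP two-volume engine `norm_markedSum_sub_markedSum_le` outputs
once [II] (1.33)–(1.36) organise the terms as a polymer gas with volume-universal activities below the wrapping scale (engine UNCONSUMED here).  A two-volume DIFFERENCE of the kernel letter: S-wrap EXEMPT.  A displayed hypothesis
SHAPE; inhabited nowhere in the tree. [cite: Balaban1987RG1, (1.21) p.264, (1.7) p.261, (1.18) p.263, (0.20) p.256; Balaban1988RG2, (1.33)–(1.36); KoteckyPreiss1986, Theorem p. 492 (4)] -/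
def RecordPvolTwoVolExpOnRunsAx (F : T4Family) (a₀ ε₂₉ γ E₀ κ : ℝ) : Prop :=
  0 < κ ∧ ∀ (n : ℕ) (gs : ℕ → ℝ), RGEqH n (betaOfRecord₁₃Ax F 2 (thetaFill F a₀ ε₂₉)) gs → Step.InInterval γ n gs → ∀ k, k ≤ n →
    ∀ (μ ν : Fin 4) (z : Fin 4 → ℤ), ∃ K₀ : ℕ, ∀ K : ℕ, K₀ ≤ K →
      |recordPvolAx F a₀ ε₂₉ k (prefixOf gs k) (K + 1) μ ν z - recordPvolAx F a₀ ε₂₉ k (prefixOf gs k) K μ ν z|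
        ≤ E₀ * Real.exp (-(κ * (((F.P K).sitesPerDir (k + 1) : ℕ) : ℝ)))

/-- **The letter ⟹ the two-volume rate row of ✓p812885** (§1: `r = e^{−κ}`, `C = |E₀|`, threshold `max K₀ (2k+2)`).
[cite: Balaban1987RG1, (1.21) p.264, (1.7) p.261] -/
theorem twoVolumeRateRow_of_twoVolExp (F : T4Family) (a₀ ε₂₉ : ℝ) {γ E₀ κ : ℝ} (h : RecordPvolTwoVolExpOnRunsAx F a₀ ε₂₉ γ E₀ κ) :
    ∀ (n : ℕ) (gs : ℕ → ℝ), RGEqH n (betaOfRecord₁₃Ax F 2 (thetaFill F a₀ ε₂₉)) gs → Step.InInterval γ n gs → ∀ k, k ≤ n →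
      ∀ (μ ν : Fin 4) (z : Fin 4 → ℤ), ∃ C r : ℝ, r < 1 ∧ ∃ K₀ : ℕ, ∀ K : ℕ, K₀ ≤ K →
        |recordPvolAx F a₀ ε₂₉ k (prefixOf gs k) (K + 1) μ ν z - recordPvolAx F a₀ ε₂₉ k (prefixOf gs k) K μ ν z| ≤ C * r ^ K := by
  intro n gs hrg hI k hk μ ν z
  obtain ⟨K₀, hK₀⟩ := h.2 n gs hrg hI k hk μ ν z
  exact geomRow_of_expScale h.1 (natCast_le_sitesPerDir F k) hK₀

/-- **The letter ⟹ (L-lim) `RecordPolLimitOnRunsAx F a₀ ε₂₉ γ` BY NAME** (`recordPolLimitOnRunsAx_of_twoVolumeGeomRate`, ✓p812885).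
[cite: Balaban1987RG1, (1.21) p.264, (1.7) p.261, (0.20) p.256] -/
theorem recordPolLimitOnRunsAx_of_twoVolExp (F : T4Family) (a₀ ε₂₉ : ℝ) {γ E₀ κ : ℝ}
    (h : RecordPvolTwoVolExpOnRunsAx F a₀ ε₂₉ γ E₀ κ) : RecordPolLimitOnRunsAx F a₀ ε₂₉ γ :=
  recordPolLimitOnRunsAx_of_twoVolumeGeomRate F a₀ ε₂₉ (twoVolumeRateRow_of_twoVolExp F a₀ ε₂₉ h)

/-- ★★★ **`hRate` OF ✓p812885 BY NAME, VERBATIM, from the letter supplied under the token-free JOIN antecedents** in the threshold form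
«∃ εL > 0, ∀ ε₂₉ ≤ εL, ∃ γ₀ > 0, ∀ γ ≤ γ₀, ∃ E₀ κ, RecordPvolTwoVolExpOnRunsAx F a₀ ε₂₉ γ E₀ κ».  CONDITIONAL; nothing of Bałaban asserted.
[cite: Balaban1987RG1, Thm 1 p.259, (1.19) p.263, (1.21) p.264; Balaban1985Variational, Thm 1 p.279, Prop. 9 p.309] -/
theorem hRate_of_twoVolExp
    (hE : ∀ F : T4Family, ∃ Mth : ℕ, ∀ Mc : ℕ, Mth ≤ Mc → ∀ (j c c₀ c₁ : ℕ) (B₃ B₃' a₀ a₁ : ℝ), JoinAntecedents (fun _ _ _ => True) F Mc j c c₀ c₁ B₃ B₃' a₀ a₁ →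
      ∃ εL : ℝ, 0 < εL ∧ ∀ ε₂₉ : ℝ, 0 < ε₂₉ → ε₂₉ ≤ εL → ∃ γ₀ : ℝ, 0 < γ₀ ∧ ∀ γ : ℝ, γ ≤ γ₀ →
        ∃ E₀ κ : ℝ, RecordPvolTwoVolExpOnRunsAx F a₀ ε₂₉ γ E₀ κ) :
    ∀ F : T4Family, ∃ Mth : ℕ, ∀ Mc : ℕ, Mth ≤ Mc → ∀ (j c c₀ c₁ : ℕ) (B₃ B₃' a₀ a₁ : ℝ), JoinAntecedents (fun _ _ _ => True) F Mc j c c₀ c₁ B₃ B₃' a₀ a₁ →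
      ∃ εL : ℝ, 0 < εL ∧ ∀ ε₂₉ : ℝ, 0 < ε₂₉ → ε₂₉ ≤ εL → ∃ γ₀ : ℝ, 0 < γ₀ ∧ ∀ γ : ℝ, γ ≤ γ₀ →
        ∀ (n : ℕ) (gs : ℕ → ℝ), RGEqH n (betaOfRecord₁₃Ax F 2 (thetaFill F a₀ ε₂₉)) gs → Step.InInterval γ n gs → ∀ k, k ≤ n →
          ∀ (μ ν : Fin 4) (z : Fin 4 → ℤ), ∃ C r : ℝ, r < 1 ∧ ∃ K₀ : ℕ, ∀ K : ℕ, K₀ ≤ K →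
            |recordPvolAx F a₀ ε₂₉ k (prefixOf gs k) (K + 1) μ ν z - recordPvolAx F a₀ ε₂₉ k (prefixOf gs k) K μ ν z| ≤ C * r ^ K := by
  intro F
  obtain ⟨Mth, hM⟩ := hE F
  refine ⟨Mth, fun Mc hMc j c c₀ c₁ B₃ B₃' a₀ a₁ hA => ?_⟩
  obtain ⟨εL, hεL, hL⟩ := hM Mc hMc j c c₀ c₁ B₃ B₃' a₀ a₁ hA
  refine ⟨εL, hεL, fun ε₂₉ hε hεle => ?_⟩
  obtain ⟨γ₀, hγ₀, hγ⟩ := hL ε₂₉ hε hεle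
  refine ⟨γ₀, hγ₀, fun γ hγle => ?_⟩
  obtain ⟨E₀, κ, hEx⟩ := hγ γ hγle
  exact twoVolumeRateRow_of_twoVolExp F a₀ ε₂₉ hEx

/-- ★★★ **THE K0ᴬ DOOR FROM THE LETTER [E] ∧ (L-dec)′ ∧ P0, BY NAME** (via ✓p812885
`record13SepCoPHInhabitedAx_of_twoVolumeRate_pvolDecayEv_tokFree` with `hRate := hRate_of_twoVolExp hE`).  Every displayed object is
S-wrap-EXEMPT (a two-volume difference of the kernel letter; the per-volume kernel letter; P0 binders).  CONDITIONAL helper; K0ᴬ OPEN; the mass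
gap is NOT proved. [cite: Balaban1987RG1, Thm 1 p.259, Thm 3 p.264, (1.21)–(1.22) p.264, (4.37) p.291, (5.10) p.293; Balaban1985Variational, Thm 1 (8)–(9) p.279; Balaban1988Convergent, Thm 1 p.262] -/
theorem record13SepCoPHInhabitedAx_of_twoVolExp_pvolDecayEv_tokFree
    (hE : ∀ F : T4Family, ∃ Mth : ℕ, ∀ Mc : ℕ, Mth ≤ Mc → ∀ (j c c₀ c₁ : ℕ) (B₃ B₃' a₀ a₁ : ℝ), JoinAntecedents (fun _ _ _ => True) F Mc j c c₀ c₁ B₃ B₃' a₀ a₁ →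
      ∃ εL : ℝ, 0 < εL ∧ ∀ ε₂₉ : ℝ, 0 < ε₂₉ → ε₂₉ ≤ εL → ∃ γ₀ : ℝ, 0 < γ₀ ∧ ∀ γ : ℝ, γ ≤ γ₀ →
        ∃ E₀ κ : ℝ, RecordPvolTwoVolExpOnRunsAx F a₀ ε₂₉ γ E₀ κ)
    (hDec : ∀ F : T4Family, ∃ Mth : ℕ, ∀ Mc : ℕ, Mth ≤ Mc → ∀ (j c c₀ c₁ : ℕ) (B₃ B₃' a₀ a₁ : ℝ), JoinAntecedents (fun _ _ _ => True) F Mc j c c₀ c₁ B₃ B₃' a₀ a₁ →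
      ∃ εD : ℝ, 0 < εD ∧ ∀ ε₂₉ : ℝ, 0 < ε₂₉ → ε₂₉ ≤ εD → ∃ γ₀ C δ₁ : ℝ, 0 < γ₀ ∧ ∀ γ : ℝ, γ ≤ γ₀ → RecordPvolDecayEvOnRunsAx F a₀ ε₂₉ γ C δ₁)
    (hUk : ∀ F : T4Family, ∃ aU : ℝ, 0 < aU ∧ ∀ (B₃ a₀ a₁ : ℝ), 2 * (F.L : ℝ) ^ 2 ≤ B₃ → 0 < a₀ → a₀ ≤ aU → 0 < a₁ → ∃ M₀ : ℕ, ∀ Mc : ℕ, McGuard F Mc → M₀ ≤ Mc →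
      (∀ ε₁ : ℝ, 0 < ε₁ → ε₁ ≤ a₁ → B₃ * ε₁ ≤ a₀ → ∀ (k n : ℕ) (V : Literature.MathematicalPhysics.QuantumFieldTheory.Balaban1983to89.GaugeField (F.P (Summit.QuantumFields.YangMills.Theorems.K0RecordFormatNames.recordK₀ F Mc k + n)) (k + 1) (Literature.MathematicalPhysics.QuantumFieldTheory.Balaban1983to89.Node00.SU 2)), Literature.MathematicalPhysics.QuantumFieldTheory.Balaban1983to89.PlaqSmall ε₁ V → Literature.MathematicalPhysics.QuantumFieldTheory.Balaban1983to89.Node00.UkExists F 2 (Summit.QuantumFields.YangMills.Theorems.K0RecordFormatNames.recordK₀ F Mc k + n) (k + 1) a₀ V ∧ Literature.MathematicalPhysics.QuantumFieldTheory.Balaban1983to89.Node00.UniqueUkOrbit F 2 (Summit.QuantumFields.YangMills.Theorems.K0RecordFormatNames.recordK₀ F Mc k + n) (k + 1) a₀ V))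
    (hBg : ∀ F : T4Family, ∃ aB : ℝ, 0 < aB ∧ ∀ a₀ : ℝ, 0 < a₀ → a₀ ≤ aB → ∃ M₀ : ℕ, ∀ Mc : ℕ, McGuard F Mc → M₀ ≤ Mc →
      (∀ (k n : ℕ) (ε₂₉ : ℝ), 0 < ε₂₉ → letI θ := Summit.QuantumFields.YangMills.Theorems.K0RecordFormatNames.thetaFill F a₀ ε₂₉; letI := θ.instVβ₁; letI := θ.instVβ₂; letI := θ.instιβ; AnalyticAt ℝ (fun B : Summit.QuantumFields.YangMills.Theorems.K0RecordFormatNames.recordW F a₀ ε₂₉ k (Summit.QuantumFields.YangMills.Theorems.K0RecordFormatNames.recordK₀ F Mc k + n) => fun (b : Literature.MathematicalPhysics.QuantumFieldTheory.Balaban1983to89.PBond (F.P (Summit.QuantumFields.YangMills.Theorems.K0RecordFormatNames.recordK₀ F Mc k + n)) 0) (i i' : Fin 2) => ((Summit.QuantumFields.YangMills.Theorems.K0RecordFormatNames.recordBgField F θ k (Summit.QuantumFields.YangMills.Theorems.K0RecordFormatNames.recordK₀ F Mc k + n) B b : Literature.MathematicalPhysics.QuantumFieldTheory.Balaban1983to89.Node00.SU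 2) : Matrix (Fin 2) (Fin 2) ℂ) i i') 0)) :
    Summit.QuantumFields.YangMills.Theses.BalabanUVNodes.Record13SepCoPHInhabitedAx :=
  record13SepCoPHInhabitedAx_of_twoVolumeRate_pvolDecayEv_tokFree (hRate_of_twoVolExp hE) hDec hUk hBg

end Summit.QuantumFields.YangMills.Theorems.K0AxTwoVolumeRate

end
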